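import Summits.CriticalPhenomena.PercolationContinuityZ3.Theorems.PercNearOneGluingNoHeavyLowerTailKnQuestion8CoefficientwiseOffCluster
import Summits.CriticalPhenomena.PercolationContinuityZ3.Theorems.PercNearOneGluingNoHeavyLowerTailKnQuestion8CoefficientwiseGluing
import HarnessLib

/-!
# Component flips for configurations with disjoint red and blue clusters (THEOREM CC, part 1)

Support file (`--supports stmt-CriticalPhenomena-4575`, closed), prover `prim-lf-2` (gen 26).  No definitions, no named facts, no sorries; standard axioms.
Memo `prim-lf-2/CW-REDUCTION-gen26.md` §13 (THEOREM CC / THEOREM APEX).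

Setting: a finite multigraph `ends : ι → Sym2 V`, an edge set `E₀`, a root `x`; a colouring is `s ⊆ E₀` (red edges; `E₀ \ s` blue), `K = C_x(s)` the red and
`K̄ = C_x(E₀ \ s)` the blue cluster of `x`.  A colouring is *CC* if `K ∩ K̄ = {x}`.  For a vertex set `U` (in practice `U = K ∪ K̄`) the *component* of `v` is its
cluster for the edges of `E₀` with both ends in `U \ {x}`.  Results:
* `Coefficientwise.mem_openCluster_of_edge` — clusters are closed under their edges;
* `Coefficientwise.comp_subset`, `Coefficientwise.comp_closed`, `Coefficientwise.comp_subset_of_closed` — components live in `U \ {x}`, are closed under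
  `E₀`-edges inside `U \ {x}`, and lie inside every closed set they meet;
* `Coefficientwise.comp_subset_cluster` — for a CC colouring every component lies inside `K` or is disjoint from it (here: meets `K` ⇒ inside `K`);
* `Coefficientwise.mem_openCluster_restrict_comp` — a vertex `v ∈ K \ {x}` is joined to `x` by red edges incident to its component only;
* `Coefficientwise.mem_openCluster_flip_iff` — FLIP LEMMA: recolouring all `E₀`-edges incident to a union `W` of components moves `W ∩ K̄` into the red
  cluster and `W ∩ K` out of it: `C_x(s ∆ I_W) = {x} ∪ (K \ W) ∪ (W ∩ K̄)`.
[cite: KozmaNitzan2024, Questions 8–9 (§5.5 p. 36) (context: first rung of the coefficientwise programme for Question 8)]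
-/

namespace Summit.CriticalPhenomena.PercolationContinuityZ3.Theorems

open Finset Literature.Probability.Percolation
open scoped symmDiff

namespace Coefficientwise

variable {ι V : Type*}

/-- A cluster is closed under its edges: if `i ∈ s` has ends `{a, b}` and `a ∈ C_x(s)` then `b ∈ C_x(s)`. [cite: KozmaNitzan2024, §5.5 (context only; folklore)] -/
theorem mem_openCluster_of_edge (ends : ι → Sym2 V) {s : Finset ι} {x a b : V} {i : ι}
    (hi : i ∈ s) (he : ends i = s(a, b)) (ha : a ∈ openCluster (ends '' (↑s : Set ι)) x) :
    b ∈ openCluster (ends '' (↑s : Set ι)) x := by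
  by_cases hab : a = b
  · subst hab; exact ha
  have hadj : (openGraph (ends '' (↑s : Set ι))).Adj a b := by
    rw [openGraph_image_adj]; exact ⟨⟨i, hi, he⟩, hab⟩
  exact SimpleGraph.Reachable.trans ha hadj.reachable

open Classical in
/-- The component of `v ∈ U \ {x}` (its cluster for the `E₀`-edges inside `U \ {x}`) lies in `U \ {x}`. [cite: KozmaNitzan2024, §5.5 (context only; folklore)] -/
theorem comp_subset (ends : ι → Sym2 V) (E₀ : Finset ι) (U : Set V) (x : V) {v w : V} (hv : v ∈ U) (hvx : v ≠ x)
    (hw : w ∈ openCluster (ends '' (↑(E₀.filter (fun i => ∀ y ∈ ends i, y ∈ U ∧ y ≠ x)) : Set ι)) v) : w ∈ U ∧ w ≠ x := by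
  by_cases hwv : w = v
  · subst hwv; exact ⟨hv, hvx⟩
  obtain ⟨i, hi, hwi⟩ := exists_edge_of_mem_openCluster ends hw hwv
  rw [Finset.mem_filter] at hi
  exact hi.2 w hwi

open Classical in
/-- Components are closed under `E₀`-edges inside `U \ {x}`. [cite: KozmaNitzan2024, §5.5 (context only; folklore)] -/
theorem comp_closed (ends : ι → Sym2 V) (E₀ : Finset ι) (U : Set V) (x : V) {v w w' : V} {i : ι}
    (hw : w ∈ openCluster (ends '' (↑(E₀.filter (fun i => ∀ y ∈ ends i, y ∈ U ∧ y ≠ x)) : Set ι)) v)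
    (hi : i ∈ E₀) (he : ends i = s(w, w')) (hwU : w ∈ U) (hwx : w ≠ x) (hw'U : w' ∈ U) (hw'x : w' ≠ x) :
    w' ∈ openCluster (ends '' (↑(E₀.filter (fun i => ∀ y ∈ ends i, y ∈ U ∧ y ≠ x)) : Set ι)) v := by
  have hiF : i ∈ E₀.filter (fun i => ∀ y ∈ ends i, y ∈ U ∧ y ≠ x) := by
    rw [Finset.mem_filter]; refine ⟨hi, fun y hy => ?_⟩
    rw [he, Sym2.mem_iff] at hy
    rcases hy with rfl | rfl
    · exact ⟨hwU, hwx⟩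
    · exact ⟨hw'U, hw'x⟩
  exact mem_openCluster_of_edge ends hiF he hw

open Classical in
/-- A set `W` closed under `E₀`-edges inside `U \ {x}` contains the component of each of its vertices. [cite: KozmaNitzan2024, §5.5 (context only; folklore)] -/
theorem comp_subset_of_closed (ends : ι → Sym2 V) (E₀ : Finset ι) (U : Set V) (x : V) {W : Set V}
    (hWc : ∀ w ∈ W, ∀ i ∈ E₀, ∀ w', ends i = s(w, w') → w' ∈ U → w' ≠ x → w' ∈ W) {w y : V} (hw : w ∈ W)
    (hy : y ∈ openCluster (ends '' (↑(E₀.filter (fun i => ∀ y ∈ ends i, y ∈ U ∧ y ≠ x)) : Set ι)) w) : y ∈ W := by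
  change (openGraph _).Reachable w y at hy
  rw [SimpleGraph.reachable_iff_reflTransGen] at hy
  induction hy with
  | refl => exact hw
  | @tail b c _ hbc ih =>
    rw [openGraph_image_adj] at hbc
    obtain ⟨⟨j, hjF, hj⟩, _⟩ := hbc
    rw [Finset.mem_filter] at hjF
    obtain ⟨hjE, hjends⟩ := hjF
    obtain ⟨hcU, hcx⟩ := hjends c (by rw [hj]; exact Sym2.mem_mk_right b c)
    exact hWc b ih j hjE c hj hcU hcx

open Classical in
/-- For a CC colouring (`C_x(s) ∩ C_x(E₀ \ s) = {x}`) a component of `U = K ∪ K̄` that meets the red cluster `K` lies inside it.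
[cite: KozmaNitzan2024, §5.5 (context only; folklore)] -/
theorem comp_subset_cluster (ends : ι → Sym2 V) {E₀ s : Finset ι} {x v w : V}
    (hCC : ∀ y, y ∈ openCluster (ends '' (↑s : Set ι)) x → y ∈ openCluster (ends '' (↑(E₀ \ s) : Set ι)) x → y = x)
    (hv : v ∈ openCluster (ends '' (↑s : Set ι)) x) (hvx : v ≠ x)
    (hw : w ∈ openCluster (ends '' (↑(E₀.filter (fun i => ∀ y ∈ ends i,
      y ∈ (openCluster (ends '' (↑s : Set ι)) x ∪ openCluster (ends '' (↑(E₀ \ s) : Set ι)) x) ∧ y ≠ x)) : Set ι)) v) :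
    w ∈ openCluster (ends '' (↑s : Set ι)) x ∧ w ≠ x := by
  set U : Set V := openCluster (ends '' (↑s : Set ι)) x ∪ openCluster (ends '' (↑(E₀ \ s) : Set ι)) x with hU
  change (openGraph _).Reachable v w at hw
  rw [SimpleGraph.reachable_iff_reflTransGen] at hw
  induction hw with
  | refl => exact ⟨hv, hvx⟩
  | @tail b c _ hbc ih =>
    obtain ⟨hbK, hbx⟩ := ih
    rw [openGraph_image_adj] at hbc
    obtain ⟨⟨i, hiF, hi⟩, _⟩ := hbc
    rw [Finset.mem_filter] at hiF
    obtain ⟨hiE, hends⟩ := hiF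
    obtain ⟨hcU, hcx⟩ := hends c (by rw [hi]; exact Sym2.mem_mk_right b c)
    refine ⟨?_, hcx⟩
    by_cases his : i ∈ s
    · exact mem_openCluster_of_edge ends his hi hbK
    · have hib : i ∈ E₀ \ s := Finset.mem_sdiff.mpr ⟨hiE, his⟩
      rcases hcU with hcK | hcKb
      · exact hcK
      · -- then `b` would be blue as well, contradicting CC
        have hbKb : b ∈ openCluster (ends '' (↑(E₀ \ s) : Set ι)) x :=
          mem_openCluster_of_edge ends hib (hi.trans Sym2.eq_swap) hcKb
        exact absurd (hCC b hbK hbKb) hbx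

open Classical in
/-- CONFINEMENT: for a CC colouring, a vertex `v ∈ K \ {x}` is joined to `x` by a red path all of whose edges are incident to the component of `v`.
[cite: KozmaNitzan2024, §5.5 (context only; folklore)] -/
theorem mem_openCluster_restrict_comp (ends : ι → Sym2 V) {E₀ s : Finset ι} {x v : V} (hs : s ⊆ E₀)
    (hCC : ∀ y, y ∈ openCluster (ends '' (↑s : Set ι)) x → y ∈ openCluster (ends '' (↑(E₀ \ s) : Set ι)) x → y = x)
    (hv : v ∈ openCluster (ends '' (↑s : Set ι)) x) (hvx : v ≠ x) :
    v ∈ openCluster (ends '' (↑(s.filter (fun i => ∃ w, w ∈ openCluster (ends '' (↑(E₀.filter (fun i => ∀ y ∈ ends i,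
      y ∈ (openCluster (ends '' (↑s : Set ι)) x ∪ openCluster (ends '' (↑(E₀ \ s) : Set ι)) x) ∧ y ≠ x)) : Set ι)) v ∧ w ∈ ends i)) : Set ι)) x := by
  set U : Set V := openCluster (ends '' (↑s : Set ι)) x ∪ openCluster (ends '' (↑(E₀ \ s) : Set ι)) x with hU
  set C : Set V := openCluster (ends '' (↑(E₀.filter (fun i => ∀ y ∈ ends i, y ∈ U ∧ y ≠ x)) : Set ι)) v with hC
  set s' : Finset ι := s.filter (fun i => ∃ w, w ∈ C ∧ w ∈ ends i) with hs'
  -- a red walk from `a ∈ C ∪ {x}` to `x` is, up to its first visit of `x`, a walk of the restricted red graph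
  have key : ∀ (a b : V) (p : (openGraph (ends '' (↑s : Set ι))).Walk a b), b = x → (a = x ∨ a ∈ C) →
      (openGraph (ends '' (↑s' : Set ι))).Reachable a b := by
    intro a b p
    induction p with
    | nil => intro _ _; exact SimpleGraph.Reachable.refl _
    | @cons a b c hadj p ih =>
      intro hc ha
      rcases ha with rfl | haC
      · subst hc; exact SimpleGraph.Reachable.refl _
      · rw [openGraph_image_adj] at hadj
        obtain ⟨⟨i, his, hi⟩, hab⟩ := hadj
        have haK : a ∈ openCluster (ends '' (↑s : Set ι)) x ∧ a ≠ x := comp_subset_cluster ends hCC hv hvx haC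
        have hbK : b ∈ openCluster (ends '' (↑s : Set ι)) x := mem_openCluster_of_edge ends his hi haK.1
        have his' : i ∈ s' := by
          rw [hs', Finset.mem_filter]; exact ⟨his, a, haC, by rw [hi]; exact Sym2.mem_mk_left a b⟩
        have hadj' : (openGraph (ends '' (↑s' : Set ι))).Adj a b := by
          rw [openGraph_image_adj]; exact ⟨⟨i, his', hi⟩, hab⟩
        have hb : b = x ∨ b ∈ C := by
          by_cases hbx : b = x
          · exact Or.inl hbx
          · exact Or.inr (comp_closed ends E₀ U x haC (hs his) hi (Or.inl haK.1) haK.2 (Or.inl hbK) hbx)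
        exact hadj'.reachable.trans (ih hc hb)
  obtain ⟨p⟩ := (show (openGraph (ends '' (↑s : Set ι))).Reachable x v from hv)
  exact (key v x p.reverse rfl (Or.inr (mem_openCluster_self _ _))).symm

open Classical in
/-- FLIP LEMMA.  Let `s ⊆ E₀` be CC, `U = K ∪ K̄`, and `W ⊆ U \ {x}` closed under `E₀`-edges inside `U \ {x}` (a union of components); let
`I = {i ∈ E₀ : i meets W}`.  Then the red cluster of the flipped colouring `s ∆ I` is `{x} ∪ (K \ W) ∪ (W ∩ K̄)`.
[cite: KozmaNitzan2024, §5.5 (context only; folklore)] -/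
theorem mem_openCluster_flip_iff (ends : ι → Sym2 V) {E₀ s : Finset ι} {x : V} (hs : s ⊆ E₀)
    (hCC : ∀ y, y ∈ openCluster (ends '' (↑s : Set ι)) x → y ∈ openCluster (ends '' (↑(E₀ \ s) : Set ι)) x → y = x)
    (W : Set V)
    (hWU : ∀ w ∈ W, (w ∈ openCluster (ends '' (↑s : Set ι)) x ∨ w ∈ openCluster (ends '' (↑(E₀ \ s) : Set ι)) x) ∧ w ≠ x)
    (hWc : ∀ w ∈ W, ∀ i ∈ E₀, ∀ w', ends i = s(w, w') →
      (w' ∈ openCluster (ends '' (↑s : Set ι)) x ∨ w' ∈ openCluster (ends '' (↑(E₀ \ s) : Set ι)) x) → w' ≠ x → w' ∈ W)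
    (y : V) :
    y ∈ openCluster (ends '' (↑(s ∆ (E₀.filter (fun i => ∃ w, w ∈ W ∧ w ∈ ends i))) : Set ι)) x ↔
      y = x ∨ (y ∈ openCluster (ends '' (↑s : Set ι)) x ∧ y ∉ W) ∨ (y ∈ W ∧ y ∈ openCluster (ends '' (↑(E₀ \ s) : Set ι)) x) := by
  set K : Set V := openCluster (ends '' (↑s : Set ι)) x with hK
  set Kb : Set V := openCluster (ends '' (↑(E₀ \ s) : Set ι)) x with hKb
  set I : Finset ι := E₀.filter (fun i => ∃ w, w ∈ W ∧ w ∈ ends i) with hI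
  set s' : Finset ι := s ∆ I with hs'def
  have memI : ∀ {i : ι}, i ∈ I ↔ i ∈ E₀ ∧ ∃ w, w ∈ W ∧ w ∈ ends i := fun {i} => by rw [hI, Finset.mem_filter]
  have mems' : ∀ {i : ι}, i ∈ s' ↔ (i ∈ s ∧ i ∉ I) ∨ (i ∈ I ∧ i ∉ s) := fun {i} => by rw [hs'def, Finset.mem_symmDiff]
  constructor
  · -- `⊆`: the right-hand side contains `x` and is closed under the red edges of `s'`
    intro hy
    change (openGraph _).Reachable x y at hy
    rw [SimpleGraph.reachable_iff_reflTransGen] at hy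
    induction hy with
    | refl => exact Or.inl rfl
    | @tail a b _ hab ih =>
      rw [openGraph_image_adj] at hab
      obtain ⟨⟨i, his', hi⟩, hne⟩ := hab
      have hbi : b ∈ ends i := by rw [hi]; exact Sym2.mem_mk_right a b
      have hai : a ∈ ends i := by rw [hi]; exact Sym2.mem_mk_left a b
      rcases mems'.mp his' with ⟨his, hiI⟩ | ⟨hiI, hins⟩
      · -- an unflipped red edge: not incident to `W`
        have hiE : i ∈ E₀ := hs his
        have hbW : b ∉ W := fun hbW => hiI (memI.mpr ⟨hiE, b, hbW, hbi⟩)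
        have haW : a ∉ W := fun haW => hiI (memI.mpr ⟨hiE, a, haW, hai⟩)
        rcases ih with rfl | ⟨haK, -⟩ | ⟨haW', -⟩
        · exact Or.inr (Or.inl ⟨mem_openCluster_of_edge ends his hi (mem_openCluster_self _ _), hbW⟩)
        · exact Or.inr (Or.inl ⟨mem_openCluster_of_edge ends his hi haK, hbW⟩)
        · exact absurd haW' haW
      · -- a flipped edge: blue in `s`, incident to `W`
        obtain ⟨hiE, w, hwW, hwi⟩ := memI.mp hiI
        have hib : i ∈ E₀ \ s := Finset.mem_sdiff.mpr ⟨hiE, hins⟩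
        rcases ih with rfl | ⟨haK, haW⟩ | ⟨haW, haKb⟩
        · -- `a = x`: then `w = b ∈ W`, and `b` is blue
          have hbKb : b ∈ Kb := mem_openCluster_of_edge ends hib hi (mem_openCluster_self _ _)
          have hwb : w = b := by
            rw [hi, Sym2.mem_iff] at hwi
            rcases hwi with rfl | rfl
            · exact absurd rfl (hWU _ hwW).2
            · rfl
          subst hwb
          exact Or.inr (Or.inr ⟨hwW, hbKb⟩)
        · -- `a ∈ K \ W`, `a ≠ x`?  if `a = x` handled as above; else the other end `w = b ∈ W` is adjacent to `a` inside `U \ {x}`, forcing `a ∈ W`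
          by_cases hax : a = x
          · subst hax
            have hbKb : b ∈ Kb := mem_openCluster_of_edge ends hib hi (mem_openCluster_self _ _)
            have hwb : w = b := by
              rw [hi, Sym2.mem_iff] at hwi
              rcases hwi with rfl | rfl
              · exact absurd rfl (hWU _ hwW).2
              · rfl
            subst hwb
            exact Or.inr (Or.inr ⟨hwW, hbKb⟩)
          · have hwb : w = b := by
              rw [hi, Sym2.mem_iff] at hwi
              rcases hwi with rfl | rfl
              · exact absurd hwW haW
              · rfl
            subst hwb
            exact absurd (hWc w hwW i hiE a (hi.trans Sym2.eq_swap) (Or.inl haK) hax) haW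
        · -- `a ∈ W ∩ K̄`: blue edge keeps `b` blue; `b = x` or `b ∈ W` by closedness
          have hbKb : b ∈ Kb := mem_openCluster_of_edge ends hib hi haKb
          by_cases hbx : b = x
          · exact Or.inl hbx
          · exact Or.inr (Or.inr ⟨hWc a haW i hiE b hi (Or.inr hbKb) hbx, hbKb⟩)
  · -- `⊇`: confinement
    rintro (rfl | ⟨hyK, hyW⟩ | ⟨hyW, hyKb⟩)
    · exact mem_openCluster_self _ _
    · by_cases hyx : y = x
      · subst hyx; exact mem_openCluster_self _ _
      -- red path to `y` using edges incident to the component of `y`, which avoids `W`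
      have hconf := mem_openCluster_restrict_comp ends hs hCC hyK hyx
      refine openCluster_mono (Set.image_mono ?_) x hconf
      intro i hi
      rw [Finset.mem_coe, Finset.mem_filter] at hi
      obtain ⟨his, w, hwC, hwi⟩ := hi
      rw [Finset.mem_coe, mems']
      refine Or.inl ⟨his, fun hiI => ?_⟩
      obtain ⟨hiE, w₁, hw₁W, hw₁i⟩ := memI.mp hiI
      -- `w ∈ comp(y)` and `w₁ ∈ W` are both ends of `i`: either equal, or adjacent inside `U \ {x}`; both give `w ∈ W`, then `y ∈ W`
      have hwU : w ∈ (K ∪ Kb) ∧ w ≠ x := comp_subset ends E₀ (K ∪ Kb) x (Or.inl hyK) hyx hwC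
      have hwW : w ∈ W := by
        by_cases hww : w = w₁
        · rw [hww]; exact hw₁W
        · have hi' : ends i = s(w₁, w) := by
            have := Sym2.mem_and_mem_iff (x := w₁) (y := w) (z := ends i) (Ne.symm hww)
            exact (this.mp ⟨hw₁i, hwi⟩)
          exact hWc w₁ hw₁W i hiE w hi' hwU.1 hwU.2
      -- closedness of `W` propagates along the component from `w` back to `y`
      have hyC : y ∈ openCluster (ends '' (↑(E₀.filter (fun i => ∀ y' ∈ ends i, y' ∈ (K ∪ Kb) ∧ y' ≠ x)) : Set ι)) w :=
        (show (openGraph _).Reachable y w from hwC).symm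
      have : y ∈ W := comp_subset_of_closed ends E₀ (K ∪ Kb) x hWc hwW hyC
      exact absurd this hyW
    · have hyx : y ≠ x := (hWU y hyW).2
      -- blue path to `y` inside its component `⊆ W`: all its edges are flipped to red
      have hCC' : ∀ y', y' ∈ openCluster (ends '' (↑(E₀ \ s) : Set ι)) x → y' ∈ openCluster (ends '' (↑(E₀ \ (E₀ \ s)) : Set ι)) x → y' = x := by
        intro y' h1 h2
        rw [Finset.sdiff_sdiff_eq_self hs] at h2
        exact hCC y' h2 h1
      have hconf := mem_openCluster_restrict_comp ends Finset.sdiff_subset hCC' hyKb hyx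
      rw [Finset.sdiff_sdiff_eq_self hs] at hconf
      refine openCluster_mono (Set.image_mono ?_) x hconf
      intro i hi
      rw [Finset.mem_coe, Finset.mem_filter] at hi
      obtain ⟨hib, w, hwC, hwi⟩ := hi
      rw [Finset.mem_sdiff] at hib
      rw [Finset.mem_coe, mems']
      refine Or.inr ⟨memI.mpr ⟨hib.1, w, ?_, hwi⟩, hib.2⟩
      -- the component of `y` (computed with `U` written as `K̄ ∪ K`) lies in `W`
      have hU' : (openCluster (ends '' (↑(E₀ \ s) : Set ι)) x ∪ openCluster (ends '' (↑s : Set ι)) x) = (K ∪ Kb) := Set.union_comm _ _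
      rw [hU'] at hwC
      exact comp_subset_of_closed ends E₀ (K ∪ Kb) x hWc hyW hwC

end Coefficientwise

end Summit.CriticalPhenomena.PercolationContinuityZ3.Theorems
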